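import Mathlib
import HarnessLib
import Summits.HubbardSuperconductivity.HubbardSuperconductivity.Theorems.KLProgrammeKLRegimeEngineKernelMomentumLipschitz
import Summits.HubbardSuperconductivity.HubbardSuperconductivity.Theorems.KLProgrammeKLRegimeWickCrossContractionNorms

/-!
# Route `KLProgramme` — ENGINE item stmt-HubbardSuperconductivity-20437, class #6 / (E5-F)ₙ producer, route (M): LEG-ORDER plumbing (M4) — the class-#6 size
# `fixedTupleL1` of a conserving polynomial does not depend on the ORDER of the legs, and vanishes for charge- or spin-unbalanced tuples

Cell gate-hubbard-kl, seat hubbard-kl-k3c2-p2 (g11; owner-designate of M1 + M3 of route (M)).  The M3 shape `fixedTupleL1_klIsoKernelAt_le_of_value_moments_counts`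
(…EngineIsoBoxNearFar, p574730) is stated for BGM-ORDERED label tuples (charges `(+,−,+,−)`, spins `(σ,σ,σ′,σ′)`), the order in which the (E5-F) value `klQuarticValue` is read;
the (E5-F)ₙ conclusion quantifies over every `Ω ∈ bgmSectorSet (klIsoFamily …) 4`.  The reduction is bookkeeping: the sectorised kernels are jointly antisymmetric in labels and
positions (`sectorisedKernel_comp_perm`), the all-legs `L¹` sum is therefore order-invariant, and for a conserving polynomial the pinned sum is the all-legs sum over `|Λ|`
(`sum_eq_card_mul_sum_pinned`, `norm_sectorisedKernel_translate`); tuples whose charges (or spins against charges) do not balance carry the zero kernel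
(`kernel_klEffectiveAction_eq_zero_of_charge/_spin`).  This file:

* §1 `sum_norm_sectorisedKernel_comp_perm` (any `G`): `Σ_x ‖W_{Ω∘σ}(x)‖ = Σ_x ‖W_Ω(x)‖`; **`fixedTupleL1_sectorisedKernel_comp_perm`** (conserving `G`):
  `fixedTupleL1 β m W (Ω ∘ σ) x₁ = fixedTupleL1 β m W Ω x₁` for EVERY `σ ∈ Perm (Fin (m+1))` (also those moving the pinned leg); instance `fixedTupleL1_klIsoKernelAt_comp_perm`;
* §2 `sectorisedKernel_klEffectiveAction_eq_zero_of_charge/_of_spin`, **`fixedTupleL1_klIsoKernelAt_eq_zero_of_charge/_of_spin`** — unbalanced tuples have size `0`.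

So every iso tuple of (E5-F)ₙ is either trivial, or a permutation of a BGM-ordered one with spins `(σ,σ,σ′,σ′)` (covered by the M3 shape at `(σ,σ′) = (0,1)`, by spin flip at `(1,0)`),
or has four equal spins (the SU(2) case M4 (i), see M3-SHAPE.md §3).  Everything is proved; no definitions; nothing about the model is asserted.
References: BGM 2006 §2.1 (symmetries), §2.3 (2.17), §2.7 (2.70)–(2.71a) [cite: BenfattoGiulianiMastropietro2006].
-/

noncomputable section

namespace Summit.HubbardSuperconductivity.HubbardSuperconductivity.Theorems.EngineV8

set_option linter.dupNamespace false -- summit = problem name (single-conjunct summit), D-0017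

open Classical
open Real Finset Complex Literature.MathematicalPhysics.QuantumLattice Literature.Probability.LatticeModels GrassmannAlgebra
open Summit.HubbardSuperconductivity.HubbardSuperconductivity.Theorems.KLProgrammeLegKernels
open Summit.HubbardSuperconductivity.HubbardSuperconductivity.Theorems.KLRegimeSplit
open scoped ComplexConjugate

open Summit.HubbardSuperconductivity.HubbardSuperconductivity.Theorems.KLRegimeWick

variable {L M : ℕ} [NeZero L] [NeZero M]

/-! ## §1 Leg-order invariance -/

section Perm

omit [NeZero M] in
/-- **The all-legs `L¹` sum is invariant under leg permutations** (any polynomial): `Σ_x ‖W_{Ω∘σ}(x)‖ = Σ_x ‖W_Ω(x)‖` (joint antisymmetry + reindexing `x ↦ x ∘ σ`). -/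
theorem sum_norm_sectorisedKernel_comp_perm {N m : ℕ} (β : ℝ) (F : Fin N → FreqMomentum L M → ℂ) (G : HubbardGrassmann L M)
    (σ : Equiv.Perm (Fin m)) (Ω : Fin m → SectorLeg N) :
    ∑ x : Fin m → SpaceTimeIdx L M, ‖sectorisedKernel L M β F G m (Ω ∘ σ) x‖ = ∑ x : Fin m → SpaceTimeIdx L M, ‖sectorisedKernel L M β F G m Ω x‖ := by
  -- reindex `x = x' ∘ σ`
  set e : (Fin m → SpaceTimeIdx L M) ≃ (Fin m → SpaceTimeIdx L M) := σ.symm.arrowCongr (Equiv.refl _) with he_def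
  have he : ∀ x : Fin m → SpaceTimeIdx L M, e x = x ∘ σ := fun x => by
    funext i; simp [he_def, Equiv.arrowCongr_apply]
  rw [← e.sum_comp]
  refine sum_congr rfl fun x _ => ?_
  rw [he, sectorisedKernel_comp_perm, norm_mul]
  have h1 : ‖(((Equiv.Perm.sign σ : ℤ)) : ℂ)‖ = 1 := by
    rcases Int.units_eq_one_or (Equiv.Perm.sign σ) with h | h <;> simp [h]
  rw [h1, one_mul]

/-- **`fixedTupleL1` IS LEG-ORDER INVARIANT for a conserving polynomial**: `fixedTupleL1 β m W (Ω ∘ σ) x₁ = fixedTupleL1 β m W Ω x₁` for every permutation `σ` of the `m+1` legs —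
including those that move the pinned leg (both sides are `ε^m/|Λ|` times the all-legs sum, by translation invariance). -/
theorem fixedTupleL1_sectorisedKernel_comp_perm {N m : ℕ} {β : ℝ} (hβ : β ≠ 0) (F : Fin N → FreqMomentum L M → ℂ) (G : HubbardGrassmann L M)
    (hfreq : ∀ (m : ℕ) (X : Fin m → HubbardFieldIdx L M),
      (∑ i, (if (X i).2 = 0 then (1 : ℤ) else -1) * matsubaraInt M (X i).1.1.1) ≠ 0 → kernel ℂ G m X = 0)
    (hmom : ∀ (m : ℕ) (X : Fin m → HubbardFieldIdx L M), (∑ i, signedMomentum L (X i).2 (X i).1.1.2) ≠ 0 → kernel ℂ G m X = 0)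
    (σ : Equiv.Perm (Fin (m + 1))) (Ω : Fin (m + 1) → SectorLeg N) (x₁ : SpaceTimeIdx L M) :
    fixedTupleL1 L M β m (sectorisedKernel L M β F G (m + 1)) (Ω ∘ σ) x₁ = fixedTupleL1 L M β m (sectorisedKernel L M β F G (m + 1)) Ω x₁ := by
  have hcard : (0 : ℝ) < Fintype.card (SpaceTimeIdx L M) := by exact_mod_cast Fintype.card_pos
  have key := fun (Ω' : Fin (m + 1) → SectorLeg N) => sum_eq_card_mul_sum_pinned (fun x => ‖sectorisedKernel L M β F G (m + 1) Ω' x‖)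
    (fun x a => norm_sectorisedKernel_translate hβ F G hfreq hmom (m + 1) Ω' x a) x₁
  have h := sum_norm_sectorisedKernel_comp_perm β F G σ Ω
  rw [key (Ω ∘ σ), key Ω] at h
  unfold fixedTupleL1
  rw [mul_left_cancel₀ hcard.ne' h]

/-- **The class-#6 size is leg-order invariant**: `fixedTupleL1 β 3 (klIsoKernelAt … K n m) (Ω ∘ σ) x₁ = fixedTupleL1 β 3 (klIsoKernelAt … K n m) Ω x₁` (`β ≠ 0`). -/
theorem fixedTupleL1_klIsoKernelAt_comp_perm {β : ℝ} (hβ : β ≠ 0) (U μ : ℝ) (K : TrigPolyC4v) (n m : ℕ)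
    (σ : Equiv.Perm (Fin 4)) (Ω : Fin 4 → SectorLeg (sectorCount (2 * m))) (x₁ : SpaceTimeIdx L M) :
    fixedTupleL1 L M β 3 (klIsoKernelAt L M β U μ K n m) (Ω ∘ σ) x₁ = fixedTupleL1 L M β 3 (klIsoKernelAt L M β U μ K n m) Ω x₁ :=
  fixedTupleL1_sectorisedKernel_comp_perm hβ (klIsoFamily L M β μ K klE0 m) (klEffectiveAction L M β U μ K klE0 n)
    (fun _ _ hX => kernel_klEffectiveAction_eq_zero_of_freq β U μ K klE0 n hX)
    (fun m' X hX => klEffectiveAction_momentumConserving β U μ K klE0 n m' X hX) σ Ω x₁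

end Perm

/-! ## §2 Charge- or spin-unbalanced tuples are trivial -/

section Balance

/-- The sectorised kernels of `𝒱ₙ[K]` VANISH on charge-unbalanced label tuples (`Σ_i s_{c_i} ≠ 0`): every momentum kernel in the defining sum is zero
(`kernel_klEffectiveAction_eq_zero_of_charge`). -/
theorem sectorisedKernel_klEffectiveAction_eq_zero_of_charge {N m : ℕ} (β : ℝ) (F : Fin N → FreqMomentum L M → ℂ) (U μ : ℝ) (K : TrigPolyC4v) (e₀ : ℝ) (n : ℕ)
    (Ω : Fin m → SectorLeg N) (hc : (∑ i, (if (Ω i).2 = 0 then (1 : ℤ) else -1)) ≠ 0) (x : Fin m → SpaceTimeIdx L M) :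
    sectorisedKernel L M β F (klEffectiveAction L M β U μ K e₀ n) m Ω x = 0 := by
  rw [sectorisedKernel_def]
  refine sum_eq_zero fun k _ => ?_
  rw [kernel_klEffectiveAction_eq_zero_of_charge β U μ K e₀ n (by simpa using hc), mul_zero]

/-- The sectorised kernels of `𝒱ₙ[K]` VANISH on spin-unbalanced label tuples (`Σ_i s_{c_i}·[σ_i = ↑] ≠ 0`) (`kernel_klEffectiveAction_eq_zero_of_spin`). -/
theorem sectorisedKernel_klEffectiveAction_eq_zero_of_spin {N m : ℕ} (β : ℝ) (F : Fin N → FreqMomentum L M → ℂ) (U μ : ℝ) (K : TrigPolyC4v) (e₀ : ℝ) (n : ℕ)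
    (Ω : Fin m → SectorLeg N) (hs : (∑ i, (if (Ω i).2 = 0 then (1 : ℤ) else -1) * (if (Ω i).1.2 = 0 then 1 else 0)) ≠ 0)
    (x : Fin m → SpaceTimeIdx L M) :
    sectorisedKernel L M β F (klEffectiveAction L M β U μ K e₀ n) m Ω x = 0 := by
  rw [sectorisedKernel_def]
  refine sum_eq_zero fun k _ => ?_
  rw [kernel_klEffectiveAction_eq_zero_of_spin β U μ K e₀ n (by simpa using hs), mul_zero]

/-- **Charge-unbalanced iso tuples have class-#6 size `0`.** -/
theorem fixedTupleL1_klIsoKernelAt_eq_zero_of_charge (β U μ : ℝ) (K : TrigPolyC4v) (n m : ℕ) (Ω : Fin 4 → SectorLeg (sectorCount (2 * m)))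
    (hc : (∑ i, (if (Ω i).2 = 0 then (1 : ℤ) else -1)) ≠ 0) (x₁ : SpaceTimeIdx L M) :
    fixedTupleL1 L M β 3 (klIsoKernelAt L M β U μ K n m) Ω x₁ = 0 := by
  unfold fixedTupleL1
  rw [sum_eq_zero fun y _ => ?_, mul_zero]
  rw [show klIsoKernelAt L M β U μ K n m Ω (Matrix.vecCons x₁ y) =
      sectorisedKernel L M β (klIsoFamily L M β μ K klE0 m) (klEffectiveAction L M β U μ K klE0 n) 4 Ω (Matrix.vecCons x₁ y) from rfl,
    sectorisedKernel_klEffectiveAction_eq_zero_of_charge β _ U μ K klE0 n Ω hc, norm_zero]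

/-- **Spin-unbalanced iso tuples have class-#6 size `0`.** -/
theorem fixedTupleL1_klIsoKernelAt_eq_zero_of_spin (β U μ : ℝ) (K : TrigPolyC4v) (n m : ℕ) (Ω : Fin 4 → SectorLeg (sectorCount (2 * m)))
    (hs : (∑ i, (if (Ω i).2 = 0 then (1 : ℤ) else -1) * (if (Ω i).1.2 = 0 then 1 else 0)) ≠ 0) (x₁ : SpaceTimeIdx L M) :
    fixedTupleL1 L M β 3 (klIsoKernelAt L M β U μ K n m) Ω x₁ = 0 := by
  unfold fixedTupleL1
  rw [sum_eq_zero fun y _ => ?_, mul_zero]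
  rw [show klIsoKernelAt L M β U μ K n m Ω (Matrix.vecCons x₁ y) =
      sectorisedKernel L M β (klIsoFamily L M β μ K klE0 m) (klEffectiveAction L M β U μ K klE0 n) 4 Ω (Matrix.vecCons x₁ y) from rfl,
    sectorisedKernel_klEffectiveAction_eq_zero_of_spin β _ U μ K klE0 n Ω hs, norm_zero]

end Balance

end Summit.HubbardSuperconductivity.HubbardSuperconductivity.Theorems.EngineV8

end
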